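import Summits.ResolutionOfSingularities.ResolutionOfSingularities.Theorems.FrobeniusLadderFInjectiveMacaulayficationFullLastCentreDefs
import HarnessLib

/-!
# K10b — RESIDUAL DECOMPOSITIONS EXIST; a multiplicity-3 origin is not a drop point
# (crux `FInjectiveMacaulayfication` stmt-ResolutionOfSingularities-15315, chain w45a; companion of K10 `…FullLastCentreAxisOrder` and of the crux workfile
# `Cruxes/FInjectiveMacaulayfication/Lines/T_canon_door.lean` v5, whose chain-level typed conjecture `MC8cChain` uses these two lemmas; seat res-L1-w45a-lead-1 g16)

[OURS · L1 W4.5a] Support file (`--supports stmt-ResolutionOfSingularities-15315 --as helper`); replaces the role of NO printed item; NOT a statement of any manuscript;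
proves nothing of the crux; OURS counted 0. AI-written (AI review is weaker than expert review).
* ★ `exists_isResidual`: for every finite set `Exc` of exceptional letters and every nonzero `D ∈ k[y₁..y₄]` there are `α` (the letterwise minimal exponents on `Exc`,
  zero elsewhere) and `N = Σ_e c_e·y^{e−α}` with `IsResidual Exc D α N` (`D = y^α·N`, `α` supported on `Exc`, `N` prime to every exceptional letter). This is the
  existence half of «`ρ = ord₀ N` is well defined»; uniqueness is not needed downstream.
* `not_isDropPoint_of_permissible_univ`: a stage of multiplicity 3 at the origin (`Permissible S univ`) is not a drop point (`b₂(0) = 0`).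
Exponent bookkeeping only; no named fact.
-/

-- single-problem summit: the doubled namespace component is forced
set_option linter.dupNamespace false

noncomputable section

open MvPolynomial Finsupp
open Summit.ResolutionOfSingularities.ResolutionOfSingularities.Theorems.FInjectiveMacaulayfication.LastCentreDefs

namespace Summit.ResolutionOfSingularities.ResolutionOfSingularities.Theorems.FInjectiveMacaulayfication.LastCentreResidual

variable {k : Type} [Field k]

/-- EVERY NONZERO `D` HAS A RESIDUAL DECOMPOSITION w.r.t. any set of exceptional letters: `α_n = min` exponent of `n` over `supp D` for `n ∈ Exc` (else `0`) and
`N = Σ_e c_e y^{e−α}`. [OURS · L1 W4.5a · proved] -/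
theorem exists_isResidual (Exc : Finset Letter) (D : YPoly k) (hD : D ≠ 0) : ∃ (α : Expo) (N : YPoly k), IsResidual Exc D α N := by
  classical
  have hne : D.support.Nonempty := MvPolynomial.support_nonempty.mpr hD
  let m : Letter → ℕ := fun n => (D.support.image fun e : Expo => e n).min' (hne.image _)
  let α : Expo := ∑ n ∈ Exc, Finsupp.single n (m n)
  have hα : ∀ n, α n = if n ∈ Exc then m n else 0 := by
    intro n
    simp only [α, Finset.sum_apply', Finsupp.single_apply]
    rw [Finset.sum_ite_eq' Exc n]
  have hle : ∀ e ∈ D.support, α ≤ e := by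
    intro e he n
    rw [hα]
    split_ifs with hn
    · exact Finset.min'_le _ _ (Finset.mem_image_of_mem _ he)
    · exact Nat.zero_le _
  let N : YPoly k := ∑ e ∈ D.support, monomial (e - α) (coeff e D)
  have hcoeff : ∀ e₀ ∈ D.support, coeff (e₀ - α) N = coeff e₀ D := by
    intro e₀ he₀
    simp only [N, coeff_sum, coeff_monomial]
    rw [Finset.sum_eq_single e₀]
    · rw [if_pos rfl]
    · intro e he hne'
      rw [if_neg]
      intro h
      apply hne'
      have := congrArg (· + α) h
      simp only [tsub_add_cancel_of_le (hle e he), tsub_add_cancel_of_le (hle e₀ he₀)] at this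
      exact this
    · intro h; exact absurd he₀ h
  refine ⟨α, N, ?_, ?_, ?_⟩
  · -- D = y^α · N
    simp only [N, Finset.mul_sum, monomial_mul, one_mul]
    conv_lhs => rw [D.as_sum]
    refine Finset.sum_congr rfl fun e he => ?_
    rw [add_tsub_cancel_of_le (hle e he)]
  · intro n hn; rw [hα, if_neg hn]
  · intro n hn
    obtain ⟨e, he, hmin⟩ : ∃ e ∈ D.support, e n = m n := by
      have := Finset.min'_mem (D.support.image fun e : Expo => e n) (hne.image _)
      obtain ⟨e, he, h⟩ := Finset.mem_image.mp this
      exact ⟨e, he, h⟩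
    refine ⟨e - α, MvPolynomial.mem_support_iff.mpr (by rw [hcoeff e he]; exact MvPolynomial.mem_support_iff.mp he), ?_⟩
    simp only [Finsupp.coe_tsub, Pi.sub_apply, hα, if_pos hn, hmin, Nat.sub_self]

/-- The initial stage is never a drop point (multiplicity 3: `b₂(0) = 0`). [OURS · L1 W4.5a · plumbing] -/
theorem not_isDropPoint_of_permissible_univ {S : Stage k} (h : Permissible S Finset.univ) : ¬ IsDropPoint S := by
  intro hd
  have h0 : (0 : Expo) ∈ S.b₂.support := MvPolynomial.mem_support_iff.mpr hd.1
  have := h.1 0 h0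
  simp [norDeg] at this

end Summit.ResolutionOfSingularities.ResolutionOfSingularities.Theorems.FInjectiveMacaulayfication.LastCentreResidual

end
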